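import Mathlib
import Literature.MathematicalPhysics.QuantumFieldTheory.Balaban1983to89.B5Infimum124

/-!
# B5 p. 23: the first equation of (1.30) (momentum form of (1.25)₁), its solution (1.32) for
# `p ≠ 0`, «for p = 0 the equation implies ω̃(0) = 0», `Δ(p) = 0 ⟺ p = 0`, and the `p′ = 0`
# part of (1.34) — for the TYPED position-space operators

Source: T. Bałaban, *Propagators and renormalization transformations for lattice gauge
theories. I*, Commun. Math. Phys. 95 (1984) 17–40 (`Balaban1984PropagatorsI`, "B5"), render
`b2b-balaban-ref1/pages/1984-cmp95-propagators-rt-I/…-p007-x2.png` (journal p. 23), read as an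
image this session.

## What the paper prints (verbatim, p. 23)

«Let us write in the momentum representation the equations we have solved:
Δ²(p)λ̃(p) − Δ(p)(∂*A)~(p) + \overline{u_k(p)} ω̃(p′) = 0,
Σ_l u_k(p′ + l)λ̃(p′ + l) = 0, (1.30)
Δ(p) = Σ_{μ=1}^{d} |∂_μ(p)|², ∂_μ(p) = (e^{iηp_μ} − 1)/η,
u_k(p) = Π_{μ=1}^{d} (e^{ip′_μ} − 1)/((e^{iηp_μ} − 1)/η) = Π_{μ=1}^{d} ∂¹_μ(p′)/∂_μ(p), (1.31)
where p′ belongs to a dual torus T̃₁^{(k)} … p ∈ T̃_η is represented as a sum p = p′ + l …»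
«The first equation in (1.30) can be solved uniquely for p ≠ 0 and we get
λ̃(p) = Δ⁻¹(p)(∂*A)~(p) − Δ⁻²(p)\overline{u_k(p)} ω̃(p′), p ≠ 0, (1.32)
for p = 0 the equation implies ω̃(0) = 0.»
«Because u_k(l) = 0 for l ≠ 0, u_k(0) = 1, so this equation implies also λ̃(0) = 0. Thus we get
the solution … for p′ ≠ 0, λ̃₀(l) = (1/Δ(l))(∂*A)~(l) for l ≠ 0, λ̃₀(0) = 0. (1.34)»

## What is typed and certified here (kernel-checked, zero sorry)

Typed dictionary (as in passes 8/10/11/19): `λ̃ = dft (fine n M) *ᵥ λ` (unitary DFT, so B5's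
`η^d`-weighted transform up to the constant `cT`), `p = p′ + l ↔ pOf n M (k, q)` (`q ↔ p′`,
`k ↔ l`), `Δ(p) = lsym (fine n M) c p` (pass 19), `u_k(p) = uSym n k (sOf M q)` (pass 3), the
momentum representation of `Q′*_k` carrying the constant `cQ = (√(n^d))⁻¹`
(`B5Adjoint130.dft_QsOp_adjoint`), `Δ = LapS (fine n M) c`, `Q′_k = QsOp n M`.
* §1 (any torus `N`): `dft_LapS_apply` (`(Δf)~(p) = Δ(p)f̃(p)`), `dft_zero_apply`, `lsym_zero`,
  `ssym_eq_zero_of_lsym`, `chi_eq_one_of_lsym`, `lsym_eq_zero_iff` — `Δ(p) = 0 ⟺ p = 0` for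
  `c ≠ 0` (via unitarity of the DFT: a character that is identically `1` is the trivial one);
* §2: `lhs130` (the printed left side of (1.30)₁ at `p = pOf (k, q)`), `dft_eq125_apply`
  (it IS the Fourier transform of the left side of (1.25)₁), `eq130_iff` — (1.25)₁ ⟺ (1.30)₁ for
  all `p` —, `eq130_lambda0` ((1.30)₁ holds at the typed `(λ₀, ω₀)` of pass 22);
* §3: `eq132` — (1.32): for `p ≠ 0` the first equation determines `λ̃(p)` —, `omega_hat_zero` —
  «for p = 0 the equation implies ω̃(0) = 0» —, `lambda0_hat_l`, `lambda0_hat_zero` — the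
  `p′ = 0` part of (1.34): `λ̃₀(l) = Δ(l)⁻¹(∂*A)~(l)` for `l ≠ 0`, `λ̃₀(0) = 0`.

## What is NOT certified here

(1.33) and the `p′ ≠ 0` part of (1.34) in momentum form (their position-space content is
passes 21/22: `omega0`, `lambda0`); fields complex, DFT normalisation `cT`/`cQ` instead of `η^d`.
-/

open scoped BigOperators Matrix ComplexConjugate ComplexOrder
open Finset Complex Matrix

namespace Literature.MathematicalPhysics.QuantumFieldTheory.Balaban1983to89.B5Momentum130

open Literature.MathematicalPhysics.QuantumFieldTheory.Balaban1983to89.B5Prop11Fiber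
open Literature.MathematicalPhysics.QuantumFieldTheory.Balaban1983to89.B5Prop11Plancherel
open Literature.MathematicalPhysics.QuantumFieldTheory.Balaban1983to89.B5Action121
open Literature.MathematicalPhysics.QuantumFieldTheory.Balaban1983to89.B5Block118
open Literature.MathematicalPhysics.QuantumFieldTheory.Balaban1983to89.B5Constraint130
open Literature.MathematicalPhysics.QuantumFieldTheory.Balaban1983to89.B5Adjoint130
open Literature.MathematicalPhysics.QuantumFieldTheory.Balaban1983to89.B5FiberZero
open Literature.MathematicalPhysics.QuantumFieldTheory.Balaban1983to89.B5LaplaceSpectral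
open Literature.MathematicalPhysics.QuantumFieldTheory.Balaban1983to89.B5LaplaceInverse
open Literature.MathematicalPhysics.QuantumFieldTheory.Balaban1983to89.B5Substitution125
open Literature.MathematicalPhysics.QuantumFieldTheory.Balaban1983to89.B5Value126

noncomputable section

/-! ## §1 `(Δf)~(p) = Δ(p)f̃(p)` and `Δ(p) = 0 ⟺ p = 0` -/

section Torus

variable {d : ℕ} (N : Fin d → ℕ) [hN : ∀ ν, NeZero (N ν)]

/-- `(Δf)~(p) = Δ(p)·f̃(p)` (the scalar Laplace operator is the multiplier `Δ(p)`).
[cite: Balaban1984PropagatorsI, (1.30) p.23] -/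
theorem dft_LapS_apply (c : ℂ) (f : Tor N → ℂ) (p : Tor N) :
    (dft N *ᵥ (LapS N c *ᵥ f)) p = lsym N c p * (dft N *ᵥ f) p := by
  rw [Matrix.mulVec_mulVec, dft_mul_LapS, ← Matrix.mulVec_mulVec, Matrix.mulVec_diagonal]

/-- `f̃(0) = cT · Σ_x f(x)`. [folklore] -/
theorem dft_zero_apply (f : Tor N → ℂ) : (dft N *ᵥ f) 0 = (cT N : ℂ) * ∑ x, f x := by
  simp only [Matrix.mulVec, dotProduct, dft_apply', chi_zero_left, map_one, mul_one]
  rw [← Finset.mul_sum]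

/-- `Δ(0) = 0`. [folklore] -/
theorem lsym_zero (c : ℂ) : lsym N c 0 = 0 := by
  simp [lsym, ssym, AddChar.map_zero_eq_one]

/-- `Δ(p) = Σ_ν |∂_ν(p)|² = 0` forces every `∂_ν(p) = 0`. [folklore] -/
theorem ssym_eq_zero_of_lsym (c : ℂ) (p : Tor N) (h : lsym N c p = 0) (ν : Fin d) :
    ssym N c ν p = 0 := by
  have hre : lsym N c p = ((∑ ν, Complex.normSq (ssym N c ν p) : ℝ) : ℂ) := by
    simp only [lsym]
    push_cast
    exact Finset.sum_congr rfl fun ν _ => by rw [Complex.normSq_eq_conj_mul_self]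
  rw [hre, Complex.ofReal_eq_zero] at h
  have := (Finset.sum_eq_zero_iff_of_nonneg fun ν _ => Complex.normSq_nonneg (ssym N c ν p)).mp
    h ν (Finset.mem_univ ν)
  exact Complex.normSq_eq_zero.mp this

/-- `Δ(p) = 0` (`c ≠ 0`) forces the character `e^{ip·x}` to be identically `1`. [folklore] -/
theorem chi_eq_one_of_lsym {c : ℂ} (hc : c ≠ 0) (p : Tor N) (h : lsym N c p = 0) (x : Tor N) :
    chi N p x = 1 := by
  unfold chi
  refine Finset.prod_eq_one fun μ _ => ?_
  have hs := ssym_eq_zero_of_lsym N c p h μ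
  have hψ : (ZMod.stdAddChar (N := N μ)) (p μ) = 1 := by
    simp only [ssym] at hs
    rcases mul_eq_zero.mp hs with h0 | h0
    · exact absurd h0 hc
    · exact sub_eq_zero.mp h0
  have hx : p μ * x μ = (x μ).val • p μ := by
    rw [nsmul_eq_mul, ZMod.natCast_zmod_val, mul_comm]
  rw [hx, AddChar.map_nsmul_eq_pow, hψ, one_pow]

/-- «Constant functions form the eigenspace corresponding to the eigenvalue 0» in momentum form:
`Δ(p) = 0 ⟺ p = 0` (`c ≠ 0`; via unitarity of the DFT). [cite: Balaban1984PropagatorsI, (1.32) p.23] -/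
theorem lsym_eq_zero_iff {c : ℂ} (hc : c ≠ 0) (p : Tor N) : lsym N c p = 0 ↔ p = 0 := by
  refine ⟨fun h => ?_, fun h => h ▸ lsym_zero N c⟩
  by_contra hp
  have hχ := chi_eq_one_of_lsym N hc p h
  have h1 := congrFun (congrFun (dft_mul_star N) p) 0
  rw [Matrix.mul_apply, Matrix.one_apply_ne hp] at h1
  simp only [Matrix.star_apply, dft_apply', hχ, chi_zero_left, map_one, mul_one, Complex.star_def,
    Complex.conj_ofReal, Finset.sum_const, nsmul_eq_mul] at h1
  have hcT : (cT N : ℂ) ≠ 0 := by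
    have : 0 < cT N := by
      unfold cT
      exact inv_pos.mpr (Real.sqrt_pos.mpr (by exact_mod_cast Fintype.card_pos))
    exact_mod_cast this.ne'
  have hcard : ((Finset.univ : Finset (Tor N)).card : ℂ) ≠ 0 := by
    exact_mod_cast Finset.card_ne_zero.mpr Finset.univ_nonempty
  exact mul_ne_zero hcard (mul_ne_zero hcT hcT) h1

end Torus

/-! ## §2 The first equation of (1.30) -/

variable {d : ℕ} (n : ℕ) [NeZero n] (M : Fin d → ℕ) [hM : ∀ μ, NeZero (M μ)] (c : ℂ)

/-- the printed left side of (1.30)₁ at `p = p′ + l = pOf (k, q)`: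
`Δ²(p)λ̃(p) − Δ(p)(∂*A)~(p) + \overline{u_k(p)} ω̃(p′)` (typed: `∂*A = b`, the `Q′*_k`-constant
`cQ` explicit). [cite: Balaban1984PropagatorsI, (1.30) p.23] -/
def lhs130 (lam b : Tor (fine n M) → ℂ) (ω : Tor M → ℂ) (k : Fin d → Fin n) (q : Tor M) : ℂ :=
  lsym (fine n M) c (pOf n M (k, q)) ^ 2 * (dft (fine n M) *ᵥ lam) (pOf n M (k, q))
    - lsym (fine n M) c (pOf n M (k, q)) * (dft (fine n M) *ᵥ b) (pOf n M (k, q))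
    + (cQ n M : ℂ) * conj (uSym n k (sOf M q)) * (dft M *ᵥ ω) q

/-- the Fourier transform of the left side of (1.25)₁, evaluated at `p = pOf (k, q)`, IS the
printed left side of (1.30)₁. [cite: Balaban1984PropagatorsI, (1.30) p.23] -/
theorem dft_eq125_apply (lam b : Tor (fine n M) → ℂ) (ω : Tor M → ℂ) (k : Fin d → Fin n)
    (q : Tor M) :
    (dft (fine n M) *ᵥ (LapS (fine n M) c *ᵥ (LapS (fine n M) c *ᵥ lam)
        - LapS (fine n M) c *ᵥ b + (QsOp n M)ᴴ *ᵥ ω)) (pOf n M (k, q))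
      = lhs130 n M c lam b ω k q := by
  rw [Matrix.mulVec_add, Matrix.mulVec_sub, Pi.add_apply, Pi.sub_apply, dft_LapS_apply,
    dft_LapS_apply, dft_LapS_apply, dft_QsOp_adjoint, lhs130]
  ring

/-- (1.25)₁ ⟺ the first equation of (1.30) at every momentum `p = p′ + l` (unitary DFT,
`pOf` bijective). [cite: Balaban1984PropagatorsI, (1.30) p.23] -/
theorem eq130_iff (lam b : Tor (fine n M) → ℂ) (ω : Tor M → ℂ) :
    LapS (fine n M) c *ᵥ (LapS (fine n M) c *ᵥ lam) - LapS (fine n M) c *ᵥ b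
        + (QsOp n M)ᴴ *ᵥ ω = 0
      ↔ ∀ k q, lhs130 n M c lam b ω k q = 0 := by
  constructor
  · intro h k q
    rw [← dft_eq125_apply, h, Matrix.mulVec_zero, Pi.zero_apply]
  · intro h
    refine dft_mulVec_eq_zero (fine n M) _ ?_
    funext p
    obtain ⟨⟨k, q⟩, rfl⟩ := (pOf_bijective n M).2 p
    rw [dft_eq125_apply, h, Pi.zero_apply]

/-- (1.30)₁ holds at the typed solution `(λ₀, ω₀)` of Sect. C (`∂*A = b ⊥ 1`, `c ≠ 0`).
[cite: Balaban1984PropagatorsI, (1.30) p.23] -/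
theorem eq130_lambda0 (hc : c ≠ 0) (b : Tor (fine n M) → ℂ) (hb : ∑ x, b x = 0)
    (k : Fin d → Fin n) (q : Tor M) :
    lhs130 n M c (lambda0 n M c b) b (omega0 n M c b) k q = 0 :=
  (eq130_iff n M c _ _ _).mp (eq125_lambda0 n M c hc b hb) k q

/-! ## §3 (1.32), `ω̃(0) = 0`, and the `p′ = 0` part of (1.34) -/

/-- (1.32): «The first equation in (1.30) can be solved uniquely for p ≠ 0 and we get
λ̃(p) = Δ⁻¹(p)(∂*A)~(p) − Δ⁻²(p)\overline{u_k(p)} ω̃(p′), p ≠ 0» (`c ≠ 0`; typed constant `cQ`).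
[cite: Balaban1984PropagatorsI, (1.32) p.23] -/
theorem eq132 (hc : c ≠ 0) (lam b : Tor (fine n M) → ℂ) (ω : Tor M → ℂ)
    (h : LapS (fine n M) c *ᵥ (LapS (fine n M) c *ᵥ lam) - LapS (fine n M) c *ᵥ b
        + (QsOp n M)ᴴ *ᵥ ω = 0)
    (k : Fin d → Fin n) (q : Tor M) (hp : pOf n M (k, q) ≠ 0) :
    (dft (fine n M) *ᵥ lam) (pOf n M (k, q))
      = (lsym (fine n M) c (pOf n M (k, q)))⁻¹ * (dft (fine n M) *ᵥ b) (pOf n M (k, q))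
        - (lsym (fine n M) c (pOf n M (k, q)))⁻¹ ^ 2
          * ((cQ n M : ℂ) * conj (uSym n k (sOf M q)) * (dft M *ᵥ ω) q) := by
  have hl : lsym (fine n M) c (pOf n M (k, q)) ≠ 0 :=
    fun h0 => hp ((lsym_eq_zero_iff (fine n M) hc _).mp h0)
  have h130 := (eq130_iff n M c lam b ω).mp h k q
  rw [lhs130] at h130
  field_simp
  linear_combination h130

/-- «for p = 0 the equation implies ω̃(0) = 0». [cite: Balaban1984PropagatorsI, (1.32) p.23] -/
theorem omega_hat_zero (lam b : Tor (fine n M) → ℂ) (ω : Tor M → ℂ)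
    (h : LapS (fine n M) c *ᵥ (LapS (fine n M) c *ᵥ lam) - LapS (fine n M) c *ᵥ b
        + (QsOp n M)ᴴ *ᵥ ω = 0) :
    (dft M *ᵥ ω) 0 = 0 := by
  have h0 := (eq130_iff n M c lam b ω).mp h 0 0
  rw [lhs130, pOf_zero, lsym_zero, uSym_sOf_zero, if_pos rfl, map_one] at h0
  have h1 : (cQ n M : ℂ) * (dft M *ᵥ ω) 0 = 0 := by linear_combination h0
  exact (mul_eq_zero.mp h1).resolve_left (cQ_ne_zero n M)

/-- (1.34), `p′ = 0`, `l ≠ 0`: `λ̃₀(l) = (1/Δ(l))(∂*A)~(l)` («Because u_k(l) = 0 for l ≠ 0»)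
(`∂*A = b ⊥ 1`, `c ≠ 0`). [cite: Balaban1984PropagatorsI, (1.34) p.23] -/
theorem lambda0_hat_l (hc : c ≠ 0) (b : Tor (fine n M) → ℂ) (hb : ∑ x, b x = 0)
    (k : Fin d → Fin n) (hk : k ≠ 0) :
    (dft (fine n M) *ᵥ lambda0 n M c b) (pOf n M (k, 0))
      = (lsym (fine n M) c (pOf n M (k, 0)))⁻¹ * (dft (fine n M) *ᵥ b) (pOf n M (k, 0)) := by
  have hp : pOf n M (k, 0) ≠ 0 := by
    intro h0
    have := pOf_injective n M (h0.trans (pOf_zero n M).symm)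
    exact hk (congrArg Prod.fst this)
  rw [eq132 n M c hc _ b _ (eq125_lambda0 n M c hc b hb) k 0 hp, uSym_sOf_zero, if_neg hk,
    map_zero]
  ring

/-- (1.34): `λ̃₀(0) = 0` (`λ₀ ⊥ 1`). [cite: Balaban1984PropagatorsI, (1.34) p.23] -/
theorem lambda0_hat_zero (b : Tor (fine n M) → ℂ) :
    (dft (fine n M) *ᵥ lambda0 n M c b) 0 = 0 := by
  rw [dft_zero_apply, sum_lambda0, mul_zero]

end

end Literature.MathematicalPhysics.QuantumFieldTheory.Balaban1983to89.B5Momentum130
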